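import Mathlib.NumberTheory.NumberField.InfinitePlace.Basic
import Mathlib.NumberTheory.LegendreSymbol.ZModChar
import Mathlib.RingTheory.DedekindDomain.Factorization
import Mathlib.RingTheory.Ideal.Norm.AbsNorm
import Mathlib.NumberTheory.NumberField.Ideal.Basic
import HarnessLib

/-!
# The norm of an algebraic integer: residue modulo `4`, sign, and `χ₄` of its factorisation

Topic `NumberTheory/QuadraticForms`; namespace `Literature.NumberTheory.QuadraticForms`; all
declarations fully proved. Three elementary facts about the absolute norm `N_{K/ℚ}` of a number
field `K`, the arithmetic behind O'Meara's Formula 71:11 (`σ_α ζ = ζ^{(-1)^r}` for `α ≡ 1` near `m`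
and integral away from `m`: there `|N_{K/ℚ} α| = ∏_𝔭 N𝔭^{ord_𝔭 α} ≡ (-1)^r N α (mod m)`) in the
case `m = 4`:

* `norm_one_add_four_mul_emod_four` : for `δ ∈ 𝓞 K`, `N(1 + 4δ) ≡ 1 (mod 4)` (the matrix of
  multiplication by `1 + 4δ` in a `ℤ`-basis of `𝓞 K` is `1 + 4M`, and `det (1 + 4M) ≡ 1 (mod 4)`);
* `norm_pos_iff_even_card` : for `x ∈ Kˣ`, `N(x) > 0` iff the number of real places `w` with
  `σ_w(x) < 0` is even — `N(x) = ∏_φ φ(x)` over the complex embeddings, and grouping `φ` with its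
  complex conjugate leaves the real embeddings times a positive number (Mathlib
  `Algebra.norm_eq_prod_embeddings`, `NumberField.InfinitePlace.card_filter_mk_eq`);
* `χ₄_absNorm_span_singleton` : for `x ∈ 𝓞 K ∖ {0}`,
  `χ₄(|N(x)|) = ∏_v χ₄(N v)^{ord_v(x)}` over the finite places, `χ₄` the non-trivial character
  modulo `4` (Mathlib `ZMod.χ₄`; `|N(x)| = N((x)) = ∏_v N(v)^{ord_v(x)}`, Mathlib
  `Ideal.absNorm_span_singleton`, `Ideal.finprod_heightOneSpectrum_factorization`).

Used in `HilbertSymbolNegOneReciprocity.lean` (O'Meara 71:13).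

## References

* O. T. O'Meara, *Introduction to quadratic forms*, Grundlehren 117, Springer (1963), §71B
  (Formula 71:11 and its proof; PDF p. 200), §15 (15:4, 15:5).
-/

noncomputable section

open NumberField IsDedekindDomain

namespace Literature.NumberTheory.QuadraticForms

variable (K : Type*) [Field K] [NumberField K]

/-! ### `N(1 + 4δ) ≡ 1 (mod 4)` -/

/-- The determinant of `1 + 4M` (`M` an integer matrix) is `≡ 1 (mod 4)` (reduce modulo `4`).
[folklore] -/
theorem Matrix.det_one_add_four_smul_emod_four {ι : Type*} [Fintype ι] [DecidableEq ι]
    (M : Matrix ι ι ℤ) : (1 + (4 : ℤ) • M).det % 4 = 1 := by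
  have h : (Int.castRingHom (ZMod 4)) (1 + (4 : ℤ) • M).det = 1 := by
    rw [RingHom.map_det, map_add, map_one]
    have h4 : (Int.castRingHom (ZMod 4)).mapMatrix ((4 : ℤ) • M) = 0 := by
      ext i j
      simp only [RingHom.mapMatrix_apply, Matrix.map_apply, Matrix.smul_apply, smul_eq_mul,
        eq_intCast, Int.cast_mul, Matrix.zero_apply]
      rw [show ((4 : ℤ) : ZMod 4) = 0 from rfl, zero_mul]
    rw [h4, add_zero, Matrix.det_one]
  rw [eq_intCast] at h
  have h1 : ((1 + (4 : ℤ) • M).det : ZMod 4) = ((1 : ℤ) : ZMod 4) := by rw [h, Int.cast_one]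
  rw [ZMod.intCast_eq_intCast_iff] at h1
  exact h1

/-- **`N_{K/ℚ}(1 + 4δ) ≡ 1 (mod 4)`** for an algebraic integer `δ ∈ 𝓞 K`: in a `ℤ`-basis of `𝓞 K`
(Mathlib `RingOfIntegers.basis`) multiplication by `1 + 4δ` has matrix `1 + 4M`. (O'Meara 15:4 /
71:11: an element `≡ 1` modulo `m` at the places above `m` has norm `≡ 1 (mod m)`.)
[cite: Omeara1963, §71B Formula 71:11 (proof)] -/
theorem norm_one_add_four_mul_emod_four (δ : 𝓞 K) : Algebra.norm ℤ (1 + 4 * δ) % 4 = 1 := by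
  classical
  let b := RingOfIntegers.basis K
  have h4 : (1 + 4 * δ : 𝓞 K) = 1 + (4 : ℤ) • δ := by rw [zsmul_eq_mul, Int.cast_ofNat]
  rw [Algebra.norm_eq_matrix_det b, h4, map_add, map_one, map_zsmul]
  exact Matrix.det_one_add_four_smul_emod_four _

/-! ### The sign of the norm -/

section Sign

open NumberField.InfinitePlace NumberField.ComplexEmbedding Finset

variable {K}

open scoped Classical in
/-- The fibre of `InfinitePlace.mk` above `w`: the embedding of `w` and its complex conjugate
(equal iff `w` is real) — the computation inside Mathlib's `card_filter_mk_eq`. [folklore] -/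
theorem filter_mk_eq (w : InfinitePlace K) :
    (univ.filter fun φ : K →+* ℂ ↦ mk φ = w) = {w.embedding, conjugate w.embedding} := by
  ext φ
  simp only [mem_filter, mem_univ, true_and, mem_insert, mem_singleton]
  constructor
  · intro h
    rcases mk_eq_iff.mp (h.trans (mk_embedding w).symm) with h1 | h1
    · exact Or.inl h1
    · right
      rw [← h1]
      change φ = star (star φ)
      rw [star_star]
  · rintro (rfl | rfl)
    · exact mk_embedding w
    · rw [mk_conjugate_eq, mk_embedding]

open scoped Classical in
/-- The product of `φ x` over the fibre above a real place is `σ_w(x)`. [folklore] -/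
theorem prod_filter_mk_eq_of_isReal {w : InfinitePlace K} (hw : w.IsReal) (x : K) :
    ∏ φ ∈ univ.filter (fun φ : K →+* ℂ ↦ mk φ = w), φ x = (embedding_of_isReal hw x : ℂ) := by
  rw [filter_mk_eq, conjugate_embedding_eq_of_isReal hw, pair_eq_singleton, prod_singleton,
    embedding_of_isReal_apply]

open scoped Classical in
/-- The product of `φ x` over the fibre above a complex place is `|σ_w(x)|²`. [folklore] -/
theorem prod_filter_mk_eq_of_isComplex {w : InfinitePlace K} (hw : w.IsComplex) (x : K) :
    ∏ φ ∈ univ.filter (fun φ : K →+* ℂ ↦ mk φ = w), φ x = (Complex.normSq (w.embedding x) : ℂ) := by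
  have hne : w.embedding ≠ conjugate w.embedding := by
    intro h
    exact (isComplex_iff.1 hw) (ComplexEmbedding.isReal_iff.2 h.symm)
  rw [filter_mk_eq, prod_pair hne, ComplexEmbedding.conjugate_coe_eq, Complex.mul_conj]

open scoped Classical in
/-- **`N_{K/ℚ}(x) = ∏_{w real} σ_w(x) · ∏_{w complex} |σ_w(x)|²`** (as complex numbers): group the
complex embeddings `φ` in `N(x) = ∏_φ φ(x)` (Mathlib `Algebra.norm_eq_prod_embeddings`) by the
infinite place they define. [folklore] -/
theorem norm_eq_prod_real_mul_prod_complex (x : K) :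
    (algebraMap ℚ ℂ (Algebra.norm ℚ x)) =
      (∏ w ∈ univ.filter (fun w : InfinitePlace K ↦ w.IsReal),
          (if hw : w.IsReal then (embedding_of_isReal hw x : ℂ) else 1)) *
        ∏ w ∈ univ.filter (fun w : InfinitePlace K ↦ w.IsComplex),
          (Complex.normSq (w.embedding x) : ℂ) := by
  rw [Algebra.norm_eq_prod_embeddings ℚ ℂ x, ← Fintype.prod_equiv RingHom.equivRatAlgHom
    (fun f : K →+* ℂ ↦ f x) (fun φ ↦ φ x) fun _ ↦ by simp [RingHom.equivRatAlgHom_apply],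
    ← prod_fiberwise univ mk (fun φ : K →+* ℂ ↦ φ x),
    ← prod_filter_mul_prod_filter_not univ (fun w : InfinitePlace K ↦ w.IsReal)]
  congr 1
  · refine prod_congr rfl fun w hw ↦ ?_
    rw [mem_filter] at hw
    rw [dif_pos hw.2, prod_filter_mk_eq_of_isReal hw.2]
  · refine prod_congr ?_ fun w hw ↦ ?_
    · ext w
      simp only [mem_filter, mem_univ, true_and, not_isReal_iff_isComplex]
    · rw [mem_filter] at hw
      exact prod_filter_mk_eq_of_isComplex hw.2 x

open scoped Classical in
/-- The sign rule for a product of non-zero reals: `∏ f > 0` iff the number of negative factors is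
even. [folklore] -/
theorem Finset.prod_pos_iff_even_card_neg {ι : Type*} (s : Finset ι) (f : ι → ℝ)
    (hf : ∀ i ∈ s, f i ≠ 0) :
    0 < ∏ i ∈ s, f i ↔ Even (s.filter fun i ↦ f i < 0).card := by
  induction s using Finset.induction_on with
  | empty => simp
  | insert a s ha ih =>
    rw [prod_insert ha, filter_insert]
    have hfa : f a ≠ 0 := hf a (mem_insert_self a s)
    have ih' := ih fun i hi ↦ hf i (mem_insert_of_mem hi)
    have hprod : ∏ i ∈ s, f i ≠ 0 := prod_ne_zero_iff.2 fun i hi ↦ hf i (mem_insert_of_mem hi)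
    by_cases hneg : f a < 0
    · rw [if_pos hneg, card_insert_of_notMem (by simp [ha]), Nat.even_add_one, ← ih']
      constructor
      · intro h hpos
        have : f a * ∏ i ∈ s, f i < 0 := mul_neg_of_neg_of_pos hneg hpos
        linarith
      · intro h
        rcases lt_or_gt_of_ne hprod with hlt | hgt
        · exact mul_pos_of_neg_of_neg hneg hlt
        · exact absurd hgt h
    · rw [if_neg hneg, ← ih']
      have hpos : 0 < f a := lt_of_le_of_ne (not_lt.1 hneg) hfa.symm
      constructor
      · intro h
        exact pos_of_mul_pos_right h hpos.le
      · intro h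
        exact mul_pos hpos h

/-- **The sign of the norm** (O'Meara 15:5 / 71:11: `N_{F/ℚ} α = (-1)^r |N_{F/ℚ} α|` with `r` the
number of real spots at which `α` is negative): for `x ∈ Kˣ`, `N_{K/ℚ}(x) > 0` iff the number of
real places `w` with `σ_w(x) < 0` is even. [cite: Omeara1963, §71B Formula 71:11 (proof)] -/
theorem norm_pos_iff_even_ncard {x : K} (hx : x ≠ 0) :
    0 < Algebra.norm ℚ x ↔
      Even {w : InfinitePlace K | ∃ hw : w.IsReal, embedding_of_isReal hw x < 0}.ncard := by
  classical
  -- the real factor `R` and the positive complex factor `C`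
  set R : ℝ := ∏ w ∈ univ.filter (fun w : InfinitePlace K ↦ w.IsReal),
    (if hw : w.IsReal then embedding_of_isReal hw x else 1) with hR
  set C : ℝ := ∏ w ∈ univ.filter (fun w : InfinitePlace K ↦ w.IsComplex),
    Complex.normSq (w.embedding x) with hC
  have hC0 : 0 < C := by
    refine prod_pos fun w _ ↦ Complex.normSq_pos.2 ?_
    exact (map_ne_zero _).2 hx
  have hnorm : ((Algebra.norm ℚ x : ℚ) : ℝ) = R * C := by
    have h := norm_eq_prod_real_mul_prod_complex x
    apply Complex.ofReal_injective
    rw [Complex.ofReal_mul, hR, hC, Complex.ofReal_prod, Complex.ofReal_prod,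
      Complex.ofReal_ratCast,
      ← eq_ratCast (algebraMap ℚ ℂ), h]
    congr 1
    refine prod_congr rfl fun w _ ↦ ?_
    split_ifs <;> simp
  rw [← Rat.cast_pos (K := ℝ), hnorm, mul_pos_iff_of_pos_right hC0, hR,
    Finset.prod_pos_iff_even_card_neg _ _ (fun w hw ↦ by
      rw [mem_filter] at hw
      rw [dif_pos hw.2]
      exact (map_ne_zero _).2 hx),
    Set.ncard_eq_toFinset_card', Set.toFinset_setOf]
  congr! 2
  ext w
  simp only [mem_filter, mem_univ, true_and]
  constructor
  · rintro ⟨hw, h⟩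
    rw [dif_pos hw] at h
    exact ⟨hw, h⟩
  · rintro ⟨hw, h⟩
    rw [dif_pos hw]
    exact ⟨hw, h⟩

end Sign

/-! ### `χ₄` of the absolute norm of a principal ideal -/

/-- **`χ₄(|N(x)|) = ∏_v χ₄(N v)^{ord_v(x)}`** for `x ∈ 𝓞 K ∖ {0}`: the absolute norm of `(x)` is
`|N_{K/ℚ}(x)|` (Mathlib `Ideal.absNorm_span_singleton`), `(x) = ∏_v v^{ord_v(x)}`
(`Ideal.finprod_heightOneSpectrum_factorization`), and `Ideal.absNorm`, `χ₄` are multiplicative.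
[folklore] -/
theorem χ₄_absNorm_span_singleton (x : 𝓞 K) (hx : x ≠ 0) :
    ZMod.χ₄ ((Algebra.norm ℤ x).natAbs : ZMod 4) =
      ∏ᶠ v : HeightOneSpectrum (𝓞 K), (ZMod.χ₄ (Ideal.absNorm v.asIdeal : ZMod 4)) ^
        (Associates.mk v.asIdeal).count (Associates.mk (Ideal.span {x})).factors := by
  have hI : (Ideal.span {x} : Ideal (𝓞 K)) ≠ 0 := by
    rw [Ne, Ideal.zero_eq_bot, Ideal.span_singleton_eq_bot]
    exact hx
  rw [← Ideal.absNorm_span_singleton x]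
  conv_lhs => rw [← Ideal.finprod_heightOneSpectrum_factorization hI]
  let f : ℕ →* ℤ := (ZMod.χ₄.toMonoidHom).comp (Nat.castRingHom (ZMod 4)).toMonoidHom
  have hf : ∀ n : ℕ, f n = ZMod.χ₄ (n : ZMod 4) := fun n ↦ rfl
  have hsupp := Ideal.hasFiniteMulSupport hI
  rw [map_finprod Ideal.absNorm hsupp, ← hf,
    f.map_finprod (hsupp.fun_comp (g := fun I : Ideal (𝓞 K) ↦ Ideal.absNorm I) (map_one _))]
  refine finprod_congr fun v ↦ ?_
  rw [hf, HeightOneSpectrum.maxPowDividing, map_pow, Nat.cast_pow, map_pow]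

end Literature.NumberTheory.QuadraticForms
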